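import Mathlib
import HarnessLib
import Summits.AnomalousDissipation.AnomalousDissipation.Theses.NeutralTaylorWaves

/-!
# Sketch — crux idea `symmetric-centrifugal-rolls` for `NeutralTaylorWaves.NonresonantSelection`
(stmt-AnomalousDissipation-16294; crux-ideate round 1, ideator k = 1)

First checkable statements of the line (typed over existing declarations; NOT proved here):

* `BlochSplitting` — the EXACT symmetry reduction that starts the line: at a base `w` invariant under the
  axial shift `x ↦ x + e₃/N` (the intended witnesses are `1/n`-periodic in `x₃`), the bordered a-priori bound
  for ALL smooth divergence-free mean-zero test triples `(v, r, b)` follows from (i) the bordered bound on the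
  shift-INVARIANT sector and (ii) an un-bordered bound on the sector of zero shift-average — because the
  linearised operator commutes with the shift, the Reynolds average is the orthogonal projection onto
  invariants, the border column `b ∂₃w` and the phase functional `⟨·, ∂₃w⟩` live in the invariant sector.
  (The same statement holds for every character of `ℤ/N`; the real, two-sector form is what types today
  without complexifying the test class.)
* `SelectionDichotomy` — the arithmetic content of "selection of a subsequence of n" once the dangerous
  block is REAL with O(1)-spaced Bohr–Sommerfeld levels whose phase is `2π n Φ₀/m + Φ₁ + o(1)`:
  either `n α + β ∈ ℤ` for every `n`, or infinitely many `n` keep a fixed distance `δ > 0` from `ℤ`.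
* `LatticeAvoidanceAE` — the Borel–Cantelli form needed if the drift vanishes (all `n` Bloch sectors real):
  for a.e. value of one continuous design parameter, all large `n` avoid the half-integer lattice by `n⁻³`
  simultaneously in every sector `j < n`.
-/

set_option linter.dupNamespace false

noncomputable section

namespace Summit.AnomalousDissipation.AnomalousDissipation.Cruxes.NonresonantSelection.SymmetricRolls

open MeasureTheory Set Filter Topology Function
open Literature.Analysis.FunctionSpaces
open Summit.AnomalousDissipation.AnomalousDissipation.Theses.NeutralTaylorWaves

/-- The physical flat unit torus `T³` (local notation). -/
local notation "𝕋³" => UnitAddTorus (Fin 3)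
/-- Velocity values (local notation). -/
local notation "E³" => EuclideanSpace ℝ (Fin 3)

/-! ### Vocabulary -/

/-- The bordered linearised steady residual at base `(w, c)`, viscosity `ν`, acting on a test triple
`(v, r, b)`: `w·∇v + v·∇w − νΔv + ∇r − c∂₃v − b∂₃w` (verbatim the integrand of the target's last clause). -/
def linResidual (ν : ℝ) (w : 𝕋³ → E³) (c : ℝ) (v : 𝕋³ → E³) (r : 𝕋³ → ℝ) (b : ℝ) (x : 𝕋³) : E³ :=
  Torus.convect w v x + Torus.convect v w x - ν • Torus.laplacian v x + Torus.gradient r x -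
    c • Torus.partialDeriv (2 : Fin 3) v x - b • Torus.partialDeriv (2 : Fin 3) w x

/-- `BorderedBound ν w c M`: the bordered a-priori estimate (last clause of `NonresonantTaylorWaves`,
character for character, with constant `M`). Same predicate as `Birth.BorderedBound`. -/
def BorderedBound (ν : ℝ) (w : 𝕋³ → E³) (c M : ℝ) : Prop :=
  ∀ (v : 𝕋³ → E³) (r : 𝕋³ → ℝ) (b : ℝ), Torus.IsSmooth v → Torus.IsSmooth r →
    Torus.IsDivFree v → Torus.HasZeroMean v →
    MeasureTheory.integral MeasureTheory.volume (fun x => ‖v x‖ ^ 2) + b ^ 2 ≤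
      M ^ 2 * (MeasureTheory.integral MeasureTheory.volume (fun x =>
        ‖Torus.convect w v x + Torus.convect v w x - ν • Torus.laplacian v x +
          Torus.gradient r x - c • Torus.partialDeriv (2 : Fin 3) v x -
          b • Torus.partialDeriv (2 : Fin 3) w x‖ ^ 2) +
        (MeasureTheory.integral MeasureTheory.volume (fun x =>
          inner ℝ (v x) (Torus.partialDeriv (2 : Fin 3) w x))) ^ 2)

/-- The axial shift by `1/N` along `x₃`: the point `proj (e₃ / N)` of `T³`. -/
def axialShift (N : ℕ) : 𝕋³ :=
  Torus.proj (EuclideanSpace.single (2 : Fin 3) ((N : ℝ)⁻¹))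

/-- Reynolds average over the cyclic group generated by the axial shift (`N • axialShift N = 0` in `T³`,
so this is the average over the full orbit and an orthogonal projection in `L²`). -/
def axialAverage {F : Type*} [AddCommGroup F] [Module ℝ F] (N : ℕ) (v : 𝕋³ → F) : 𝕋³ → F :=
  fun x => (N : ℝ)⁻¹ • ∑ k ∈ Finset.range N, v (x + k • axialShift N)

/-! ### First lemma of the line: exact Bloch splitting of the bordered bound -/

/-- **FIRST LEMMA (`BlochSplitting`).** Let the base `w` be invariant under the axial shift by `1/N`.
If (i) the bordered bound with constant `M` holds for all smooth divergence-free mean-zero test fields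
that are shift-INVARIANT (with shift-invariant pressure tests), and (ii) the un-bordered bound
`‖u‖² ≤ M² ‖L(u, s, 0)‖²` holds for all smooth divergence-free mean-zero `u` (and smooth `s`) of ZERO
shift-average, then the bordered bound holds for every test triple, with constant `M`.
(Proof sketch: `L` is linear and commutes with the shift because `w ∘ shift = w`; `axialAverage N` is the
orthogonal projection onto shift-invariants and preserves smoothness, divergence-freeness and zero mean;
`∂₃ w` is invariant, so `b ∂₃ w` and `⟨v, ∂₃ w⟩ = ⟨Av, ∂₃ w⟩` live in the invariant sector; Pythagoras.) -/
def BlochSplitting : Prop :=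
  ∀ (N : ℕ) (ν c M : ℝ) (w : 𝕋³ → E³), 0 < N → 0 ≤ M → Torus.IsSmooth w →
    (∀ x, w (x + axialShift N) = w x) →
    -- (i) bordered bound on the shift-invariant sector
    (∀ (v : 𝕋³ → E³) (r : 𝕋³ → ℝ) (b : ℝ), Torus.IsSmooth v → Torus.IsSmooth r →
      Torus.IsDivFree v → Torus.HasZeroMean v →
      (∀ x, v (x + axialShift N) = v x) → (∀ x, r (x + axialShift N) = r x) →
      MeasureTheory.integral MeasureTheory.volume (fun x => ‖v x‖ ^ 2) + b ^ 2 ≤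
        M ^ 2 * (MeasureTheory.integral MeasureTheory.volume (fun x => ‖linResidual ν w c v r b x‖ ^ 2) +
          (MeasureTheory.integral MeasureTheory.volume (fun x =>
            inner ℝ (v x) (Torus.partialDeriv (2 : Fin 3) w x))) ^ 2)) →
    -- (ii) un-bordered bound on the zero-average sector
    (∀ (u : 𝕋³ → E³) (s : 𝕋³ → ℝ), Torus.IsSmooth u → Torus.IsSmooth s →
      Torus.IsDivFree u → Torus.HasZeroMean u →
      (∀ x, axialAverage N u x = 0) → (∀ x, axialAverage N s x = 0) →
      MeasureTheory.integral MeasureTheory.volume (fun x => ‖u x‖ ^ 2) ≤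
        M ^ 2 * MeasureTheory.integral MeasureTheory.volume (fun x => ‖linResidual ν w c u s 0 x‖ ^ 2)) →
    BorderedBound ν w c M

/-! ### The arithmetic of "selection of a subsequence of n" -/

/-- **`SelectionDichotomy`** (rotation-number dichotomy). For real `α, β`: either `n α + β` is an
integer for EVERY `n`, or there is `δ > 0` such that `n α + β` stays `δ`-far from `ℤ` for infinitely
many `n`. (Irrational `α`: the orbit is dense in `ℝ/ℤ`; rational `α = p/q`: the orbit is `q`-periodic and
visits every residue `β + k/q`.) Applied with `α = Φ₀/m`, `β = Φ₁/2π − (Maslov)`: the real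
Bohr–Sommerfeld block keeps `0` at distance `≥ c₀ δ` from its spectrum along infinitely many `n`, unless
the design is exactly resonant for all `n`, which re-choosing the axial number `m` excludes. -/
def SelectionDichotomy : Prop :=
  ∀ α β : ℝ, (∀ n : ℕ, ∃ k : ℤ, (n : ℝ) * α + β = k) ∨
    ∃ δ : ℝ, 0 < δ ∧ ∃ᶠ n : ℕ in atTop, ∀ k : ℤ, δ ≤ |(n : ℝ) * α + β - k|

/-- **`LatticeAvoidanceAE`** (Borel–Cantelli lattice avoidance; needed only in the drift-free variant,
where all `n` axial Bloch sectors are real). If `|ψ| ≥ 1` on `[0,1]`, then for a.e. design parameter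
`a ∈ [0,1]`, for all large `n` and every sector `j < n`, the phase `n (φ(j/n) + a ψ(j/n))` misses the
half-integers by at least `n⁻³`. (Measure of the bad `a`-set for fixed `(n, j)` is `≤ 6 n⁻³`; sum over
`j < n` and `n`.) -/
def LatticeAvoidanceAE : Prop :=
  ∀ (φ ψ : ℝ → ℝ), Measurable φ → Measurable ψ → (∀ s ∈ Set.Icc (0 : ℝ) 1, 1 ≤ |ψ s|) →
    ∀ᵐ a ∂(volume.restrict (Set.Icc (0 : ℝ) 1)), ∃ N : ℕ, ∀ n : ℕ, N ≤ n → ∀ j : ℕ, j < n →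
      ∀ k : ℤ, ((n : ℝ) ^ 3)⁻¹ ≤ |(n : ℝ) * (φ (j / n) + a * ψ (j / n)) - (k + 1 / 2)|

/-! ### Sanity: the splitting lemma feeds the target's last clause verbatim -/

/-- `BorderedBound ν w c (C₀ * ν⁻¹ ^ K₀)` is literally the last clause of `NonresonantTaylorWaves`
(same predicate as `Birth.BorderedBound`), so `BlochSplitting` composes with the birth line's
`stub_borderedGapStability` (order-uniformity) unchanged. -/
example (ν : ℝ) (w : 𝕋³ → E³) (c C₀ : ℝ) (K₀ : ℕ) (h : BorderedBound ν w c (C₀ * ν⁻¹ ^ K₀)) :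
    ∀ (v : 𝕋³ → E³) (r : 𝕋³ → ℝ) (b : ℝ), Torus.IsSmooth v → Torus.IsSmooth r →
      Torus.IsDivFree v → Torus.HasZeroMean v →
      MeasureTheory.integral MeasureTheory.volume (fun x => ‖v x‖ ^ 2) + b ^ 2 ≤
        (C₀ * ν⁻¹ ^ K₀) ^ 2 * (MeasureTheory.integral MeasureTheory.volume (fun x =>
          ‖Torus.convect w v x + Torus.convect v w x - ν • Torus.laplacian v x +
            Torus.gradient r x - c • Torus.partialDeriv (2 : Fin 3) v x -
            b • Torus.partialDeriv (2 : Fin 3) w x‖ ^ 2) +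
          (MeasureTheory.integral MeasureTheory.volume (fun x =>
            inner ℝ (v x) (Torus.partialDeriv (2 : Fin 3) w x))) ^ 2) := h

end Summit.AnomalousDissipation.AnomalousDissipation.Cruxes.NonresonantSelection.SymmetricRolls

end
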